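/- Copyright: the b2b-balaban cell (near-miss cell 7), T⁴-continuum fan-out, lineage t4-ne7b-p1 (node U5c COUNT
member).  Released under the licence of the surrounding project. -/
import Summits.QuantumFields.BalabanUV.T4Continuum.Support.HistoryGenealogyExtractionR
import Summits.QuantumFields.BalabanUV.T4Continuum.Support.HistoryGenealogyRealisePrint

/-!
# Genealogy REALISATION for the per-part-renewal extraction `pgenR`, PRINT-EXACT (H3-(ID), geometric half M3b-1 v2 —
repairs R-40-a ∕ R-40-b of the located model findings F-ne7bp1g40-1 ∕ -2; owner module of row NE7b, lineage
`t4-ne7b-p1` gen 40, ruling R-OWNER-40-3, row S14-R; `SCOPE-alpha.md` v2.2 §5: THE form the junction M4 consumes —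
PRE-POSITIONING ONLY)

Summits-side support leaf of the T⁴-continuum cell (rung (B)+1 on a FINITE torus only; NOT infinite volume, NOT the
mass gap, NOT the Clay statement; NOT a proof of the spine estimate NE7b, which is the cell's OWN estimate, NOT PRINTED
and NOT PROVED).  [folklore] finite combinatorics in the ℤᵈ index model over `HistoryGenealogyExtractionR` (`pgenR`,
`wrapR`, `assembleR`, `constituentsR`), row S14 (`ChainTouch`, `unionL`, `img`, `imgC`, `orbit_level_succ`,
`map_sum_elim_of_lefts_eq_nil`, `exists_inr_of_lefts_eq_nil`), its print-exact twin (`realisesP_joinTail`,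
`pendingBefore_self`) and the repair core `HistoryRealisePrint` (`RealisesP`, `PendingBefore`); nothing printed is
asserted, no `def … : Prop` fact of Bałaban's, no cite-tagged hypothesis, zero `sorry`.  B16 = [Balaban1989LargeFieldII]
pp. 381–387 and B15 = [Balaban1989LargeFieldI] p. 177 are manuscripts UNDER AUDIT; locators only (C-B16-6).

WHY.  With renewals booked PER PART (`pgenR`, F-ne7bp1g40-2) and pendency asked only STRICTLY BEFORE the join scale
(`RealisesP`, F-ne7bp1g40-1), the displayed per-level clauses take exactly the form print's construction guarantees:
(G-readyR) every part FLAGGED at level `j` (renewed by 𝐑^{(j)}) is ready at scale `j` for the first time; (G-pendR)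
every UNFLAGGED part of a joined component is pending strictly before `j + 1` («alive at level j and not renewed ⇒ not
ready at the scales ≤ j»); the rest as in row S14.  A flagged part enters a join as `renew (pgenR j p) j`, realised by
its S-image and trivially pending at its own step `j + 1`.  BY-NAME EFFECT ON THE WALL: NONE (pre-positioning).

WHAT IS DEFINED AND PROVED.  §1 `realisesP_assembleR_of_two_le` (join branch of `assembleR`, print-exact).  §2
**`edomR H rnw dom`** (last-event domain for `pgenR`: inherited through a lone UNFLAGGED part, else the current domain;
one-step equations) and **`structure LevelClausesR H rnw dom L s R : Prop`** ((G-new), (G-birth), (G-flow) — lone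
part, either flag: `dom (j+1) c = Sop (ratio L s j) (dom j p)` —, (G-readyR), (G-pendR), (G-touch), (G-join)).  §3
`cpairR`∕`cpair0R`, `constituentsR_eq_map_cpairR`, **`realisesP_pgenR`** (births via the twin's `realisesP_birth_of_new_ok`) (under `WF` + `LevelClausesR`: ∀ c ∈ comp j,
`RealisesP L s R (H.pgenR rnw j c) (edomR H rnw dom j c)` ∧ `dom j c = orbit L s (H.pgenR rnw j c).lastStep (edomR … j c)
(j − lastStep)`), `realisesP_of_mem_compR`, `dom_eq_orbitR`, `disjoint_orbit_of_disjoint_domR`, `adm_of_mem_compR`.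

HONEST.  Proves nothing of Bałaban's; the clauses are OUR reading, displayed (to be instantiated from the level sets in
M3b-2); NE7b NOT proved; spine 0∕9.  HONEST DEPENDENCY (cell): continuum YM on T⁴ ⇐ BetaPertH ∧ nine spine estimates
(0/9 proved); BetaPertH ⇐ (D1) ∧ (D4) ∧ CAP+tail; G-an2-4 gates asym, D1 and NE2/3/4.  This file changes none of it. -/

open Finset
open Literature.MathematicalPhysics.QuantumFieldTheory.Balaban1983to89
open Literature.MathematicalPhysics.QuantumFieldTheory.Balaban1983to89.B13ScaleTransfer
open Literature.MathematicalPhysics.QuantumFieldTheory.Balaban1983to89.TreeLength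
open Literature.MathematicalPhysics.QuantumFieldTheory.Balaban1983to89.B16SProfile
open Literature.MathematicalPhysics.QuantumFieldTheory.Balaban1983to89.B16MergeGeometry
open Summit.QuantumFields.BalabanUV.T4Continuum.HistoryAdmissible
open Summit.QuantumFields.BalabanUV.T4Continuum.HistoryAdmissible.PGen
open Summit.QuantumFields.BalabanUV.T4Continuum.HistoryRealise
open Summit.QuantumFields.BalabanUV.T4Continuum.HistoryRealisePrint
open Summit.QuantumFields.BalabanUV.T4Continuum.HistoryGenealogyExtraction

namespace Summit.QuantumFields.BalabanUV.T4Continuum.HistoryGenealogyRealise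

noncomputable section

variable {d : ℕ}

/-! ## §1 The join branch of `assembleR`, print-exact -/

/-- **`assembleR`, JOIN BRANCH, REALISED (print-exact pendency)**: ≥ 2 constituents listed with their domains, each
`RealisesP`-realised with `lastStep ≤ sj` and `PendingBefore … sj`, images in `ChainTouch` order ⟹ the assembled
genealogy is realised by any domain inside the union of the images, and its last step is `sj`. [folklore] -/
theorem realisesP_assembleR_of_two_le {L : ℕ} {s R : ℕ → ℕ} (c : Lab d) (sj : ℕ)
    (Ps : List (PGen (Lab d) × Finset (Pt d))) (h2 : 2 ≤ Ps.length)
    (hall : ∀ UZ ∈ Ps, RealisesP L s R UZ.1 UZ.2 ∧ UZ.1.lastStep ≤ sj ∧ PendingBefore L s R UZ.1.lastStep UZ.2 sj)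
    (hct : ChainTouch (Ps.map (img L s sj))) {Z : Finset (Pt d)} (hZ : Z ⊆ unionL (Ps.map (img L s sj))) :
    RealisesP L s R (assembleR c sj (Ps.map Prod.fst)) Z ∧ (assembleR c sj (Ps.map Prod.fst)).lastStep = sj := by
  match Ps, h2, hall, hct, hZ with
  | [], h2, _, _, _ => simp at h2
  | [_], h2, _, _, _ => simp at h2
  | TZ :: UZ :: Us, _, hall, hct, hZ =>
      obtain ⟨hT, hTs, hTp⟩ := hall TZ (by simp)
      simp only [List.map_cons, assembleR_cons_cons]
      refine ⟨?_, rfl⟩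
      have hmap : UZ.1 :: Us.map Prod.fst = (UZ :: Us).map Prod.fst := rfl
      rw [hmap]
      exact realisesP_joinTail sj TZ.1 TZ.2 (UZ :: Us) (by simp) hT hTs hTp
        (fun W hW => hall W (by simp only [List.mem_cons] at hW ⊢; exact Or.inr hW)) (by simpa using hct) Z
        (by simpa using hZ)

/-! ## §2 Last-event domains for `pgenR` and the displayed clauses -/

/-- the lone UNFLAGGED part of a constituent list, if that is what the list is (the no-event case of `pgenR`)
[folklore] -/
def lonePartR (rnw : ℕ → Lab d → Bool) (j : ℕ) : List (Lab d ⊕ Lab d) → Option (Lab d)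
  | [Sum.inl p] => if rnw j p = true then none else some p
  | _ => none

/-- `lonePartR` returns a lone unflagged part only [folklore] -/
theorem lonePartR_eq_some {rnw : ℕ → Lab d → Bool} {j : ℕ} {l : List (Lab d ⊕ Lab d)} {p : Lab d}
    (h : lonePartR rnw j l = some p) : l = [Sum.inl p] ∧ rnw j p = false := by
  match l, h with
  | [Sum.inl q], h =>
      simp only [lonePartR] at h
      split_ifs at h with hq
      simp only [Option.some.injEq] at h
      subst h
      exact ⟨rfl, by simpa using hq⟩
  | [Sum.inr _], h => simp [lonePartR] at h
  | [], h => simp [lonePartR] at h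
  | _ :: _ :: _, h => simp [lonePartR] at h

namespace GeomHistoryR

variable (H : ComponentHistory (Lab d)) (rnw : ℕ → Lab d → Bool) (dom : ℕ → Lab d → Finset (Pt d))

/-- **THE LAST-EVENT DOMAIN for `pgenR`**: inherited through a lone unflagged part (no event), the current domain at
an event level (birth, renewal — alone or merged —, join). [folklore] -/
def edomR : ℕ → Lab d → Finset (Pt d)
  | 0, c => dom 0 c
  | j + 1, c =>
      match lonePartR rnw j (H.constit (j + 1) c) with
      | some p => edomR j p
      | none => dom (j + 1) c

/-- `edomR` at level `0` [folklore] -/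
@[simp] theorem edomR_zero (c : Lab d) : edomR H rnw dom 0 c = dom 0 c := rfl

/-- `edomR` through a no-event level is inherited [folklore] -/
theorem edomR_succ_lone {j : ℕ} {c p : Lab d} (hp : H.constit (j + 1) c = [Sum.inl p]) (hr : rnw j p = false) :
    edomR H rnw dom (j + 1) c = edomR H rnw dom j p := by
  simp [edomR, lonePartR, hp, hr]

/-- `edomR` at an event level is the current domain [folklore] -/
theorem edomR_succ_event {j : ℕ} {c : Lab d} (h : lonePartR rnw j (H.constit (j + 1) c) = none) :
    edomR H rnw dom (j + 1) c = dom (j + 1) c := by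
  simp [edomR, h]

variable (L : ℕ) (s R : ℕ → ℕ)

/-- **THE DISPLAYED PER-LEVEL GEOMETRIC CLAUSES for the per-part-renewal extraction, print-exact** (OUR reading of B16
pp. 381–387 with B15 p. 177; hypothesis SHAPE, never asserted; to be instantiated from the level sets in M3b-2):
(G-new), (G-birth) as in row S14; (G-flow) a component continuing a lone part — renewed or not — flows by one
S-operation («Z = S(Z₀)»); (G-readyR) every part FLAGGED at level `j` is ready at scale `j` for the FIRST time (the
𝐑-operation renews exactly the ready components with a new field, p. 385 bottom); (G-pendR) every UNFLAGGED old part of a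
JOINED component is pending STRICTLY BEFORE the join step (alive and not renewed ⇒ unready at scales `≤ j`); (G-touch),
(G-join) as in row S14. [folklore] -/
structure LevelClausesR : Prop where
  /-- (G-new) new regions: anchored, face-connected, class at least the tree length -/
  new_ok : ∀ j, ∀ n ∈ H.newReg j, n.1 ∈ n.2 ∧ FaceConnected n.2 ∧ treeLen n.2 ≤ H.cls n
  /-- (G-birth) a lone new region is its component's domain -/
  dom_birth : ∀ j c n, c ∈ H.comp j → H.constit j c = [Sum.inr n] → dom j c = n.2
  /-- (G-flow) a component continued alone (renewed or not) flows by one S-operation -/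
  dom_flow : ∀ j c p, c ∈ H.comp (j + 1) → H.constit (j + 1) c = [Sum.inl p] →
    dom (j + 1) c = Sop (ratio L s j) (dom j p)
  /-- (G-readyR) a flagged part is ready at scale `j` for the first time -/
  ready : ∀ j c, c ∈ H.comp (j + 1) → ∀ p ∈ H.parts (j + 1) c, rnw j p = true →
    Stops L s R (H.pgenR rnw j p).lastStep (edomR H rnw dom j p) (j - (H.pgenR rnw j p).lastStep) ∧
      ∀ k, k < j - (H.pgenR rnw j p).lastStep → ¬ Stops L s R (H.pgenR rnw j p).lastStep (edomR H rnw dom j p) k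
  /-- (G-pendR) an unflagged old part of a joined component is pending strictly before the join step -/
  pend : ∀ j c, c ∈ H.comp (j + 1) → 2 ≤ (H.constit (j + 1) c).length → ∀ p ∈ H.parts (j + 1) c, rnw j p = false →
    PendingBefore L s R (H.pgenR rnw j p).lastStep (edomR H rnw dom j p) (j + 1)
  /-- (G-touch) leaf-first order: each image touches the union of the later images -/
  touch : ∀ j c, c ∈ H.comp j → 2 ≤ (H.constit j c).length → ChainTouch ((H.constit j c).map (imgC L s dom j))
  /-- (G-join) the joined domain lies inside the union of the images -/
  dom_join : ∀ j c, c ∈ H.comp j → 2 ≤ (H.constit j c).length → dom j c ⊆ unionL ((H.constit j c).map (imgC L s dom j))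

end GeomHistoryR

/-! ## §3 The realisation theorem for `pgenR`, print-exact -/

section MainR

open GeomHistoryR ComponentHistory

variable {L : ℕ} {s R : ℕ → ℕ} {H : ComponentHistory (Lab d)} {rnw : ℕ → Lab d → Bool}
  {dom : ℕ → Lab d → Finset (Pt d)}

/-- the (history, last-event domain) pairs of the constituents of a level-`(j+1)` component: a FLAGGED part enters
renewed at `j` with its S-image, an unflagged part bare with its last-event domain, a new region as a birth [folklore] -/
def cpairR (H : ComponentHistory (Lab d)) (rnw : ℕ → Lab d → Bool) (dom : ℕ → Lab d → Finset (Pt d)) (L : ℕ)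
    (s : ℕ → ℕ) (j : ℕ) : Lab d ⊕ Lab d → PGen (Lab d) × Finset (Pt d) :=
  Sum.elim
    (fun p => if rnw j p = true then (PGen.renew (H.pgenR rnw j p) j, Sop (ratio L s j) (dom j p))
      else (H.pgenR rnw j p, edomR H rnw dom j p))
    fun n => (PGen.birth (j + 1) (H.cls n) n, n.2)

/-- the pairs at level `0` (births only under `WF`) [folklore] -/
def cpair0R (H : ComponentHistory (Lab d)) (rnw : ℕ → Lab d → Bool) (dom : ℕ → Lab d → Finset (Pt d)) :
    Lab d ⊕ Lab d → PGen (Lab d) × Finset (Pt d) :=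
  Sum.elim (fun p => (H.pgenR rnw 0 p, edomR H rnw dom 0 p)) fun n => (PGen.birth 0 (H.cls n) n, n.2)

/-- the constituents' histories of a level-`(j+1)` component are the first components of `cpairR` [folklore] -/
theorem constituentsR_eq_map_cpairR (j : ℕ) (c : Lab d) :
    H.constituentsR rnw (H.pgenR rnw j) j c = ((H.constit (j + 1) c).map (cpairR H rnw dom L s j)).map Prod.fst := by
  rw [List.map_map]
  unfold ComponentHistory.constituentsR
  congr 1
  funext x
  cases x with
  | inl p => by_cases h : rnw j p = true <;> simp [cpairR, wrapR, h]
  | inr n => rfl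

/-- **THE REALISATION THEOREM FOR `pgenR`, PRINT-EXACT.**  Under `WF` and the displayed clauses `LevelClausesR`, every
extracted genealogy is `RealisesP`-realised by its last-event domain and the current domain is the orbit of the
last-event domain from the last step (induction on the level: lone unflagged part — inherited; lone flagged part —
renewal by (G-flow) + (G-readyR); lone birth; ≥ 2 constituents — the join chain with flagged parts renewed (pending at
their own step), unflagged parts by (G-pendR), births pending trivially, (G-touch), (G-join)). [folklore] -/
theorem realisesP_pgenR (hW : H.WF) (hG : LevelClausesR H rnw dom L s R) :
    ∀ (j : ℕ) (c : Lab d), c ∈ H.comp j →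
      RealisesP L s R (H.pgenR rnw j c) (edomR H rnw dom j c) ∧
        dom j c = orbit L s (H.pgenR rnw j c).lastStep (edomR H rnw dom j c) (j - (H.pgenR rnw j c).lastStep)
  | 0, c, hc => by
      have hl0 : lefts (H.constit 0 c) = [] := hW.parts_zero c
      have hne : H.constit 0 c ≠ [] := hW.nonempty 0 c hc
      have hmem : ∀ x ∈ H.constit 0 c, ∃ n, x = Sum.inr n ∧ n ∈ H.newReg 0 := by
        intro x hx
        obtain ⟨n, rfl⟩ := exists_inr_of_lefts_eq_nil hl0 x hx
        exact ⟨n, rfl, hW.news_sub 0 c hc n ((mem_rights_iff n _).2 hx)⟩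
      have hbirths : H.births 0 c = ((H.constit 0 c).map (cpair0R H rnw dom)).map Prod.fst := by
        rw [List.map_map]
        unfold ComponentHistory.births ComponentHistory.news
        rw [show Prod.fst ∘ cpair0R H rnw dom = Sum.elim (fun p => H.pgenR rnw 0 p) fun n => PGen.birth 0 (H.cls n) n
          from funext fun x => by cases x <;> rfl, map_sum_elim_of_lefts_eq_nil _ _ _ hl0]
      match hcs : H.constit 0 c, hne, hmem with
      | [], hne, _ => exact (hne rfl).elim
      | [x], _, hmem =>
          obtain ⟨n, rfl, hn⟩ := hmem x (by simp)
          rw [H.pgenR_zero_birth rnw c n hcs, edomR_zero, hG.dom_birth 0 c n hc hcs]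
          exact ⟨realisesP_birth_of_new_ok (hG.new_ok 0 n hn) 0, by simp [lastStep]⟩
      | x :: y :: l, _, hmem =>
          have h2 : 2 ≤ (H.constit 0 c).length := by rw [hcs]; simp
          have himg : ((H.constit 0 c).map (cpair0R H rnw dom)).map (img L s 0) =
              (H.constit 0 c).map (imgC L s dom 0) := by
            rw [List.map_map]
            refine List.map_congr_left fun z hz => ?_
            obtain ⟨n, rfl, -⟩ := hmem z (hcs ▸ hz)
            simp [cpair0R, img, lastStep]
          have hall : ∀ UZ ∈ (H.constit 0 c).map (cpair0R H rnw dom),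
              RealisesP L s R UZ.1 UZ.2 ∧ UZ.1.lastStep ≤ 0 ∧ PendingBefore L s R UZ.1.lastStep UZ.2 0 := by
            intro UZ hUZ
            obtain ⟨z, hz, rfl⟩ := List.mem_map.1 hUZ
            obtain ⟨n, rfl, hn⟩ := hmem z (hcs ▸ hz)
            exact ⟨realisesP_birth_of_new_ok (hG.new_ok 0 n hn) 0, le_rfl, pendingBefore_self L s R 0 _⟩
          have hct : ChainTouch (((H.constit 0 c).map (cpair0R H rnw dom)).map (img L s 0)) := by
            rw [himg]; exact hG.touch 0 c hc h2
          have hZ : dom 0 c ⊆ unionL (((H.constit 0 c).map (cpair0R H rnw dom)).map (img L s 0)) := by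
            rw [himg]; exact hG.dom_join 0 c hc h2
          have hlen : 2 ≤ ((H.constit 0 c).map (cpair0R H rnw dom)).length := by simpa using h2
          obtain ⟨hR, hlast⟩ := realisesP_assembleR_of_two_le (L := L) (s := s) (R := R) c 0 _ hlen hall hct hZ
          rw [pgenR_zero_eq, hbirths, edomR_zero]
          exact ⟨hR, by rw [hlast]; simp⟩
  | j + 1, c, hc => by
      have hne : H.constit (j + 1) c ≠ [] := hW.nonempty (j + 1) c hc
      have ih : ∀ p ∈ H.parts (j + 1) c,
          RealisesP L s R (H.pgenR rnw j p) (edomR H rnw dom j p) ∧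
            dom j p = orbit L s (H.pgenR rnw j p).lastStep (edomR H rnw dom j p) (j - (H.pgenR rnw j p).lastStep) :=
        fun p hp => realisesP_pgenR hW hG j p (hW.parts_sub j c hc p hp)
      -- the image of an old part at level `j + 1` is one S-operation of its level-`j` domain
      have himgp : ∀ p ∈ H.parts (j + 1) c,
          orbit L s (H.pgenR rnw j p).lastStep (edomR H rnw dom j p) (j + 1 - (H.pgenR rnw j p).lastStep) =
            Sop (ratio L s j) (dom j p) := by
        intro p hp
        rw [(ih p hp).2, orbit_level_succ L s (H.lastStep_pgenR_le rnw j p)]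
      match hcs : H.constit (j + 1) c, hne with
      | [], hne => exact (hne rfl).elim
      | [Sum.inl p], _ =>
          have hp : p ∈ H.parts (j + 1) c := by simp [ComponentHistory.parts, hcs]
          have ht : (H.pgenR rnw j p).lastStep ≤ j := H.lastStep_pgenR_le rnw j p
          have hflow := hG.dom_flow j c p hc hcs
          cases hf : rnw j p with
          | false =>
              -- LONE UNFLAGGED PART: no event, inherited
              rw [H.pgenR_succ_lone rnw j c p hcs hf, edomR_succ_lone H rnw dom hcs hf]
              refine ⟨(ih p hp).1, ?_⟩
              rw [hflow, ← himgp p hp]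
          | true =>
              -- LONE FLAGGED PART: renewal at the first readiness
              obtain ⟨hstop, hfirst⟩ := hG.ready j c hc p hp hf
              have hev : edomR H rnw dom (j + 1) c = dom (j + 1) c :=
                edomR_succ_event H rnw dom (by simp [lonePartR, hcs, hf])
              rw [H.pgenR_succ_renew rnw j c p hcs hf, hev]
              refine ⟨⟨edomR H rnw dom j p, (ih p hp).1, hstop, hfirst, ?_⟩, by simp [lastStep]⟩
              rw [hflow, ← himgp p hp]
      | [Sum.inr n], _ =>
          -- LONE BIRTH
          have hn : n ∈ H.newReg (j + 1) := hW.news_sub (j + 1) c hc n (by simp [ComponentHistory.news, hcs])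
          have hev : edomR H rnw dom (j + 1) c = dom (j + 1) c := edomR_succ_event H rnw dom (by simp [lonePartR, hcs])
          rw [H.pgenR_succ_birth rnw j c n hcs, hev, hG.dom_birth (j + 1) c n hc hcs]
          exact ⟨realisesP_birth_of_new_ok (hG.new_ok (j + 1) n hn) (j + 1), by simp [lastStep]⟩
      | x :: y :: l, _ =>
          -- JOIN CHAIN at step j + 1: flagged parts renewed, unflagged parts bare, births
          have h2 : 2 ≤ (H.constit (j + 1) c).length := by rw [hcs]; simp
          have hev : edomR H rnw dom (j + 1) c = dom (j + 1) c := edomR_succ_event H rnw dom (by simp [lonePartR, hcs])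
          have himg : ((H.constit (j + 1) c).map (cpairR H rnw dom L s j)).map (img L s (j + 1)) =
              (H.constit (j + 1) c).map (imgC L s dom (j + 1)) := by
            rw [List.map_map]
            refine List.map_congr_left fun z hz => ?_
            cases z with
            | inl p =>
                have hp : p ∈ H.parts (j + 1) c := (mem_lefts_iff p _).2 hz
                by_cases hf : rnw j p = true
                · simp [cpairR, hf, img, lastStep]
                · simpa [cpairR, hf, img] using himgp p hp
            | inr n => simp [cpairR, img, lastStep]
          have hall : ∀ UZ ∈ (H.constit (j + 1) c).map (cpairR H rnw dom L s j),
              RealisesP L s R UZ.1 UZ.2 ∧ UZ.1.lastStep ≤ j + 1 ∧ PendingBefore L s R UZ.1.lastStep UZ.2 (j + 1) := by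
            intro UZ hUZ
            obtain ⟨z, hz, rfl⟩ := List.mem_map.1 hUZ
            cases z with
            | inl p =>
                have hp : p ∈ H.parts (j + 1) c := (mem_lefts_iff p _).2 hz
                by_cases hf : rnw j p = true
                · -- renewed at `j`, merged at `j + 1`: realised by its S-image, pending at its own step
                  obtain ⟨hstop, hfirst⟩ := hG.ready j c hc p hp hf
                  simp only [cpairR, Sum.elim_inl, hf, if_true]
                  refine ⟨⟨edomR H rnw dom j p, (ih p hp).1, hstop, hfirst, (himgp p hp).symm⟩, le_rfl, ?_⟩
                  exact pendingBefore_self L s R (j + 1) _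
                · have hf' : rnw j p = false := by simpa using hf
                  simp only [cpairR, Sum.elim_inl, hf]
                  exact ⟨(ih p hp).1, (H.lastStep_pgenR_le rnw j p).trans (Nat.le_succ j),
                    hG.pend j c hc h2 p hp hf'⟩
            | inr n =>
                have hn : n ∈ H.newReg (j + 1) := hW.news_sub (j + 1) c hc n ((mem_rights_iff n _).2 hz)
                exact ⟨realisesP_birth_of_new_ok (hG.new_ok (j + 1) n hn) (j + 1), le_rfl,
                  pendingBefore_self L s R (j + 1) _⟩
          have hct : ChainTouch (((H.constit (j + 1) c).map (cpairR H rnw dom L s j)).map (img L s (j + 1))) := by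
            rw [himg]; exact hG.touch (j + 1) c hc h2
          have hZ : dom (j + 1) c ⊆
              unionL (((H.constit (j + 1) c).map (cpairR H rnw dom L s j)).map (img L s (j + 1))) := by
            rw [himg]; exact hG.dom_join (j + 1) c hc h2
          have hlen : 2 ≤ ((H.constit (j + 1) c).map (cpairR H rnw dom L s j)).length := by simpa using h2
          obtain ⟨hR, hlast⟩ := realisesP_assembleR_of_two_le (L := L) (s := s) (R := R) c (j + 1) _ hlen hall hct hZ
          rw [pgenR_succ_eq, constituentsR_eq_map_cpairR (dom := dom) (L := L) (s := s), hev]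
          exact ⟨hR, by rw [hlast]; simp⟩

/-- **EVERY COMPONENT'S `pgenR` GENEALOGY IS PRINT-EXACTLY REALISED by its last-event domain.** [folklore] -/
theorem realisesP_of_mem_compR (hW : H.WF) (hG : LevelClausesR H rnw dom L s R) {j : ℕ} {c : Lab d}
    (hc : c ∈ H.comp j) : RealisesP L s R (H.pgenR rnw j c) (edomR H rnw dom j c) :=
  (realisesP_pgenR hW hG j c hc).1

/-- **THE CURRENT DOMAIN IS THE ORBIT OF THE LAST-EVENT DOMAIN** (`pgenR` form). [folklore] -/
theorem dom_eq_orbitR (hW : H.WF) (hG : LevelClausesR H rnw dom L s R) {j : ℕ} {c : Lab d} (hc : c ∈ H.comp j) :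
    dom j c = orbit L s (H.pgenR rnw j c).lastStep (edomR H rnw dom j c) (j - (H.pgenR rnw j c).lastStep) :=
  (realisesP_pgenR hW hG j c hc).2

/-- disjoint current domains of distinct components transfer to the orbits (`pgenR` form) [folklore] -/
theorem disjoint_orbit_of_disjoint_domR (hW : H.WF) (hG : LevelClausesR H rnw dom L s R) {K : ℕ} {c c' : Lab d}
    (hc : c ∈ H.comp K) (hc' : c' ∈ H.comp K) (hdis : Disjoint (dom K c) (dom K c')) :
    Disjoint (orbit L s (H.pgenR rnw K c).lastStep (edomR H rnw dom K c) (K - (H.pgenR rnw K c).lastStep))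
      (orbit L s (H.pgenR rnw K c').lastStep (edomR H rnw dom K c') (K - (H.pgenR rnw K c').lastStep)) := by
  rwa [← dom_eq_orbitR hW hG hc, ← dom_eq_orbitR hW hG hc']

/-- the realised `pgenR` genealogy obeys print's timing discipline at its level (agreeing with `adm_pgenR`) [folklore] -/
theorem adm_of_mem_compR (hW : H.WF) (hG : LevelClausesR H rnw dom L s R) {j : ℕ} {c : Lab d} (hc : c ∈ H.comp j) :
    (H.pgenR rnw j c).Adm j :=
  adm_of_realisesP _ _ (realisesP_of_mem_compR hW hG hc) (H.lastStep_pgenR_le rnw j c)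

end MainR

end

end Summit.QuantumFields.BalabanUV.T4Continuum.HistoryGenealogyRealise
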